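import Summits.QuantumFields.YangMills.Theorems.FluctuationComparisonRegPrIntLS2BetaRelativeTowerSupBudget128
import Summits.QuantumFields.YangMills.Theorems.FluctuationComparisonRegPrIntLS2BetaResidualGauge
import Summits.QuantumFields.YangMills.Theorems.FluctuationComparisonRegPrIntLS2BetaHFlatOfRelativeLetter
import Summits.QuantumFields.YangMills.Theorems.FluctuationComparisonRegPrIntLS2BetaPeanoSmooth
import HarnessLib

/-!
# S2β · THE SUP CHAIN ∕ (D-stage): THE ARC LETTER `hARC` OF THE SUPPLIER KNIT, DISCHARGED FROM THE DATUM's SMALL-BOND GUARD AT THE STATION PREFIX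
# (a SUP window `((5L)²∕4)·θ i ≤ α` on `J < i ≤ K`, the (BKG) clause at the top, (E4), the residual gauge) — NO `Σθ`, NO `γ, b₀, p₀`, σ := 1∕4, θ-GENERIC

Cell `ym3-torus` (YM ladder rung R3 = continuum `SU(2)` Yang–Mills on the three-torus at fixed lattice data — a RUNG: NOT d = 4, NOT infinite volume, NOT a mass gap,
NOT Clay).  Width seat «width 12» `ym3-torus-px12` (gen 26), FREE px helper on crux `stmt-QuantumFields-20520`; `--kind proof --supports stmt-QuantumFields-20520 --as
helper`, count-neutral, DEFINITION-FREE (0 `def`, 0 `instance`, 0 `notation`, 0 `sorry`, default heartbeats).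

WHY (architect px17 g22 21:27:23Z (2): «px12 = the `hARC` supplier, θ-generic, against LEAD's `hARC` TEXT»; LEAD w3 g29 №5–№7: the SUPPLIER KNIT
`supTowerLetter3_of_arc_discSplit (hARC) (hDBX) : ∀ G, hSTL‴ G` takes the ARC PROFILE of the two gauged stage towers as the hypothesis `hARC : ∀ G, ⟨body G⟩`).
The θ-generic sup budget of this lineage (✓p834849 `exists_supBudget_128_theta`, ✓p834939 `arcProfile_theta_axStage`) asks for TWO windows on the threshold
profile — every level `θ′ i ≤ a₀(L)` AND the level SUM `Σ_{i<K−J} θ′(K−i) ≤ S₀(L)` — while the station prefix of `hARC` carries only a SUP window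
`((5L)²∕4)·θ i ≤ α` on `J < i ≤ K` (no `Σθ`; `θ J` itself unconstrained).  THE POINT OF THIS FILE: the SUP profile needs only the sup window.  The guarded
quadratic step `s_t ≤ r₀·s_{t+1} + ρ_t + C₂·s_{t+1}²` bootstraps DOWNWARD from the start `s_{K−J} ≤ M` to `s_t ≤ M ≤ 1∕4` at every level as soon as
`ρ_t ≤ (1 − r₀)∕2·M` holds POINTWISE (§0 `sup_bootstrap_start_pointwise` — ✓`sup_bootstrap_start` used `Σρ ≤ Sρ` only through `ρ_t ≤ Sρ`); the source
`ρ_t = A₁·θ(K−t) + A₂·θ(K−t−1)` is `≤ α·(A₁∕G + A₂∕G + A₂·C_B)` from the window at the internal levels and from the (BKG) clause `dist1(□ avg^{K−J} U₀) ≤ C_B·α`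
at the top (datum) level, so `α ≤ α₀(L, C_B) := Smax∕(A₁∕G + A₂∕G + A₂·C_B + 1)` suffices (§1 `exists_alpha_supBound_window`, one tower, datum guard
`arc ≤ 1∕128 ≤ M(L)` by ✓`one_div_128_le_ceiling`).  §2 `arcLetter_of_guard G hG : ⟨hARC's body at G⟩` VERBATIM (LEAD draft v1 l.103–158 == v3 l.80–135), for
every datum class `G` carrying the small-bond conjunct `G F J V → ∀ e, arc(V e) ≤ 1∕128`: the partner `W := exp(ζ)·U₀` is in the datum's fibre by (E4) and its
top plaquettes are `U₀`'s (✓`iter_eq_of_descendTo_eq`); the comparison history `U₁` (`U₀ = (g_0⁻¹·g₀_0) • U₁`) is in the fibre and in `histGood θ` by the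
residual clauses (✓`residual_of_iter_eq`, ✓`gaugeAct_mem_fibre_iff_of_residual`, ✓`gaugeAct_mem_histGood_iff`) and has the same top field; §1 is applied to
each tower.  For a class `G` WITHOUT the small-bond conjunct (G_IRR ∕ G_A′) `hARC G` stays the visible D-GUARD binder, as ruled (architect 21:27:23Z).

WHAT IS PROVED (sorry-free).  ★`sup_bootstrap_start_pointwise` (real bookkeeping), ★★`exists_alpha_supBound_window` (one tower: `∃ α₀(L, C_B) > 0`, sup window +
top (BKG) + datum guard ⟹ arcs `≤ 1∕4` at EVERY gauged level `t ≤ K − J`), ★★★`arcLetter_of_guard` (the knit's `hARC G` for every guarded `G`).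

HONEST SCOPE.  Elementary bootstrap + re-plumbing of landed letters; the window, (BKG), (E4), memberships and the 17 `AxStage` clauses are HYPOTHESES; nothing
of Bałaban's renormalisation-group analysis is asserted or proved ([Balaban1985RegularSpaces] Lemma 1 (1.24)–(1.26) p.79, (1.29) p.81 — the printed small-field
regularity this profile imitates; [Balaban1985Averaging] Prop. 4 (128)–(135) pp.37–38 — the axial-gauge ∕ averaging conventions of the stage towers).  The
SUPPLIER KNIT, `hDBX`, LIFT-LADDER's inhabitant, (ST″), LOC, D-GUARD (for unguarded `G`), GAP♯∘ (`stub_uniformFibreGapOrbit`, registry 3732b7df UNTOUCHED), the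
five registered stubs (0∕5), S2β, 20520, 19936, 19200, `YM3TorusSU2` are NOT proved; no registered stub is closed; rung R3 — NOT d = 4, NOT infinite volume,
NOT a mass gap, NOT Clay; the Yang–Mills mass gap is NOT proved.
-/

set_option autoImplicit false

noncomputable section

namespace Summit.QuantumFields.YangMills.Theorems.FluctuationComparisonRegPrIntLS2BetaArcLetterOfGuard

open Finset
open scoped Real
open Literature.MathematicalPhysics.QuantumLattice (su2Quat)
open Literature.MathematicalPhysics.QuantumFieldTheory.Balaban1983to89
open T4Continuum T3ContinuumYM3Torus T3UnitScaleTilt T3TiltDescent T3LevelShift BlockAveraging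
open T4CubeChartGnomonic (SU2)
open T4HaarSU2ExpChart (expPoint)
open T4ExpWindowSmallField (logVec)
open T3UnitLawDensityEML (ℰp)
open T3ConstrainedMinimiser (fibre)
open ExpMeanLog (deltaSU)
open B10Eq27TorusAxialLog (rel axialT)
open Summit.QuantumFields.YangMills.Theorems.FluctuationComparisonRegPrIntLS2BetaRelativeTowerSupProfileStart (exists_supProfile_relativeTower_start)
open Summit.QuantumFields.YangMills.Theorems.FluctuationComparisonRegPrIntLS2BetaRelativeTowerSupBudgetStart (norm_logVec_iter_le_of_mem_fibre)
open Summit.QuantumFields.YangMills.Theorems.FluctuationComparisonRegPrIntLS2BetaRelativeTowerSupBudget128 (one_div_128_le_ceiling)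
open Summit.QuantumFields.YangMills.Theorems.FluctuationComparisonRegPrIntLS2BetaResidualGauge
  (gaugeAct_mul_eq gaugeAct_mem_fibre_iff_of_residual gaugeAct_mem_histGood_iff)
open Summit.QuantumFields.YangMills.Theorems.FluctuationComparisonRegPrIntLS2BetaHFlatOfRelativeLetter (residual_of_iter_eq)
open Summit.QuantumFields.YangMills.Theorems.FluctuationComparisonRegPrIntLS2BetaPeanoSmooth (iter_eq_of_descendTo_eq)

/-! ## §0 The downward bootstrap with a POINTWISE source bound -/

/-- ★ **BOOTSTRAP WITH A NON-ZERO START, POINTWISE SOURCE**: `s m ≤ M`, `0 ≤ s`, `ρ t ≤ Sρ` for every `t < m`, the guarded quadratic step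
`s (t+1) ≤ σ₀ → s t ≤ r₀·s (t+1) + ρ t + C₂·s (t+1)²` (`t < m`), `0 ≤ r₀`, `0 ≤ C₂`, and the ceiling conditions `M ≤ σ₀`, `Sρ ≤ (1 − r₀)∕2·M`,
`C₂·M ≤ (1 − r₀)∕2` ⟹ EVERY level `s t ≤ M` (`t ≤ m`; downward induction `r₀M + Sρ + C₂M² ≤ M` — ✓`sup_bootstrap_start` with its `Σρ ≤ Sρ` weakened to the
pointwise bound it actually uses). [folklore] -/
theorem sup_bootstrap_start_pointwise (s ρ : ℕ → ℝ) (m : ℕ) (r₀ C₂ σ₀ M Sρ : ℝ) (hs : s m ≤ M) (hsnn : ∀ t, 0 ≤ s t)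
    (hρS : ∀ t, t < m → ρ t ≤ Sρ)
    (hstep : ∀ t, t < m → s (t + 1) ≤ σ₀ → s t ≤ r₀ * s (t + 1) + ρ t + C₂ * s (t + 1) ^ 2)
    (hr0 : 0 ≤ r₀) (hC : 0 ≤ C₂) (hMσ : M ≤ σ₀)
    (hsmall₁ : Sρ ≤ (1 - r₀) / 2 * M) (hsmall₂ : C₂ * M ≤ (1 - r₀) / 2) :
    ∀ t, t ≤ m → s t ≤ M := by
  suffices h : ∀ k, ∀ t, t + k = m → s t ≤ M by
    intro t ht
    exact h (m - t) t (by omega)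
  intro k
  induction k with
  | zero =>
    intro t ht
    have htm : t = m := by omega
    rw [htm]
    exact hs
  | succ k ih =>
    intro t ht
    have ht' : t < m := by omega
    have hS : s (t + 1) ≤ M := ih (t + 1) (by omega)
    have hS0 : 0 ≤ s (t + 1) := hsnn (t + 1)
    have h1 : r₀ * s (t + 1) ≤ r₀ * M := mul_le_mul_of_nonneg_left hS hr0
    have h2 : C₂ * s (t + 1) ^ 2 ≤ C₂ * (M * M) := mul_le_mul_of_nonneg_left (by nlinarith) hC
    have h3 : C₂ * (M * M) ≤ (1 - r₀) / 2 * M := by nlinarith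
    calc s t ≤ r₀ * s (t + 1) + ρ t + C₂ * s (t + 1) ^ 2 := hstep t ht' (hS.trans hMσ)
      _ ≤ r₀ * M + Sρ + (1 - r₀) / 2 * M := by linarith [hρS t ht']
      _ ≤ r₀ * M + (1 - r₀) / 2 * M + (1 - r₀) / 2 * M := by linarith
      _ = M := by ring

/-! ## §1 One tower: the sup bound `≤ 1∕4` from the α-window, the top (BKG) clause and the datum's guard -/

/-- ★★ **THE SUP BOUND OF A STAGE TOWER IN THE GUARD `1∕128`, SUP-WINDOW EDITION**: there is `α₀(L, C_B) > 0` such that for any threshold profile `θ ≥ 0`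
with `((5L)²∕4)·θ i ≤ α` on `J < i ≤ K`, `α ≤ 1∕24`, `α < δ_SU`, `α ≤ α₀`, a datum `Vd` with `arc(Vd e) ≤ 1∕128` at every bond, a good history
`U ∈ fibre(Vd) ∩ histGood(θ)` whose TOP averaged field has plaquettes `≤ C_B·α`, and its gauged stage tower (hat lift, (T1), (T4), (T5)): EVERY gauged level
`t ≤ K − J` has arcs `≤ 1∕4` — depth- and volume-free, NO `Σθ`, NO `γ, b₀, p₀`. [cite: Balaban1985RegularSpaces, Lemma 1 (1.24)-(1.26) p.79, (1.29) p.81] -/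
theorem exists_alpha_supBound_window (L : ℕ) (hL : 1 < L) (C_B : ℝ) (hCB : 0 ≤ C_B) :
    ∃ α₀ : ℝ, 0 < α₀ ∧ ∀ (F : T3Family) (θ : ℕ → ℝ), F.L = L → (∀ i, 0 ≤ θ i) →
      ∀ (J K : ℕ) (hJK : J ≤ K) (α : ℝ), (∀ i, J < i → i ≤ K → (((5 * F.L : ℕ) : ℝ) ^ 2 / 4) * θ i ≤ α) →
      α ≤ 1 / 24 → α < deltaSU (Fin 2) → α ≤ α₀ →
      ∀ (Vd : GaugeField (F.P J) 0 SU2), (∀ e, ‖logVec (su2Quat (Vd e))‖ ≤ 1 / 128) →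
      ∀ (U : GaugeField (F.P K) 0 SU2), U ∈ fibre F ℰp J K hJK Vd → U ∈ histGood F ℰp θ K J →
      (∀ p : Plaq (F.P K) (K - J),
        dist1 (GaugeField.plaqHol (Averaging.iter (fun k => blockAvg (P := F.P K) (j := k) ℰp) (K - J) U) p) ≤ C_B * α) →
      ∀ (g : (j : ℕ) → Site (F.P K) j → SU2) (w : (t : ℕ) → PBond (F.P K) t → PBond (F.P K) (t + 1) → ℝ)
        (V : (t : ℕ) → GaugeField (F.P K) t SU2),
        (∀ t, t < K - J → ∀ b e, w t b e = if e.dir = b.dir ∧ (b.src b.dir - emb e.src b.dir).val < (F.P K).L then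
          ∏ ν ∈ Finset.univ.erase b.dir, max 0 (1 - ((rel (emb e.src) b.src ν).natAbs : ℝ) / (F.P K).L) else 0) →
        (∀ t, t < K - J → ∀ b, V t b = expPoint (∑ e, w t b e • ((((F.P K).L : ℕ) : ℝ)⁻¹ •
          logVec (su2Quat (GaugeField.gaugeAct (g (t + 1)) (Averaging.iter (fun k => blockAvg (P := F.P K) (j := k) ℰp) (t + 1) U) e))))) →
        (∀ j, K - J ≤ j → ∀ y, g j y = 1) →
        (∀ t, t < K - J → ∀ z : Site (F.P K) t,
          axialT (GaugeField.gaugeAct (g t) (Averaging.iter (fun k => blockAvg (P := F.P K) (j := k) ℰp) t U)) (emb (blockOf z)) z =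
            axialT (V t) (emb (blockOf z)) z) →
        (∀ t, t < K - J → avgFun ℰp (GaugeField.gaugeAct (g t) (Averaging.iter (fun k => blockAvg (P := F.P K) (j := k) ℰp) t U)) =
          GaugeField.gaugeAct (g (t + 1)) (Averaging.iter (fun k => blockAvg (P := F.P K) (j := k) ℰp) (t + 1) U)) →
        ∀ t, t ≤ K - J → ∀ b,
          ‖logVec (su2Quat (GaugeField.gaugeAct (g t) (Averaging.iter (fun k => blockAvg (P := F.P K) (j := k) ℰp) t U) b))‖ ≤ 1 / 4 := by
  -- the constants of the one-level step at `d = 3`, block size `L` (px17's), as in ✓`exists_supBudget_128_theta`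
  have hL' : (1 : ℝ) < L := by exact_mod_cast hL
  have hL0 : (0 : ℝ) < L := by linarith
  obtain ⟨NP, hNP⟩ : ∃ x : ℝ, x = (((3 - 1) * ((L - 1) / 2) * (L + 1) : ℕ) : ℝ) := ⟨_, rfl⟩
  obtain ⟨G, hG⟩ : ∃ x : ℝ, x = ((((3 + 2) * L : ℕ) : ℝ) ^ 2 / 4) := ⟨_, rfl⟩
  have hNP0 : 0 ≤ NP := by rw [hNP]; positivity
  have hG0 : 0 < G := by rw [hG]; positivity
  obtain ⟨A₁, hA₁⟩ : ∃ x : ℝ, x = π / 2 * (NP + 2 * G) := ⟨_, rfl⟩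
  obtain ⟨A₂, hA₂⟩ : ∃ x : ℝ, x = π / 2 * (NP * ((L : ℝ)⁻¹) ^ 2 * (π / 2)) := ⟨_, rfl⟩
  obtain ⟨C₂, hC₂⟩ : ∃ x : ℝ, x = π / 2 * NP * 24 * ((L : ℝ)⁻¹) ^ 2 := ⟨_, rfl⟩
  obtain ⟨r₀, hr₀⟩ : ∃ x : ℝ, x = (L : ℝ)⁻¹ := ⟨_, rfl⟩
  have hA₁0 : 0 ≤ A₁ := by rw [hA₁]; positivity
  have hA₂0 : 0 ≤ A₂ := by rw [hA₂]; positivity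
  have hC₂0 : 0 ≤ C₂ := by rw [hC₂]; positivity
  have hr00 : 0 ≤ r₀ := by rw [hr₀]; positivity
  have hr01 : r₀ < 1 := by rw [hr₀]; exact inv_lt_one_of_one_lt₀ hL'
  have h1r : 0 < 1 - r₀ := by linarith
  -- the ceiling `M` and the pointwise source budget `Smax`
  obtain ⟨M, hM⟩ : ∃ x : ℝ, x = min (1 / 4) ((1 - r₀) / (2 * (C₂ + 1))) := ⟨_, rfl⟩
  have hM0 : 0 < M := by rw [hM]; exact lt_min (by norm_num) (by positivity)
  have hM4 : M ≤ 1 / 4 := by rw [hM]; exact min_le_left _ _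
  have hMC : C₂ * M ≤ (1 - r₀) / 2 := by
    have h1 : M ≤ (1 - r₀) / (2 * (C₂ + 1)) := by rw [hM]; exact min_le_right _ _
    calc C₂ * M ≤ (C₂ + 1) * ((1 - r₀) / (2 * (C₂ + 1))) := by nlinarith
      _ = (1 - r₀) / 2 := by field_simp
  obtain ⟨Smax, hSmax⟩ : ∃ x : ℝ, x = (1 - r₀) / 2 * M := ⟨_, rfl⟩
  have hSmax0 : 0 < Smax := by rw [hSmax]; positivity
  -- the source coefficient `Z` and the window `α₀`
  obtain ⟨Z, hZ⟩ : ∃ x : ℝ, x = A₁ / G + A₂ / G + A₂ * C_B := ⟨_, rfl⟩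
  have hZ0 : 0 ≤ Z := by rw [hZ]; positivity
  obtain ⟨α₀, hα₀⟩ : ∃ x : ℝ, x = Smax / (2 * (Z + 1)) := ⟨_, rfl⟩
  have hα₀0 : 0 < α₀ := by rw [hα₀]; positivity
  -- the slack turning the top's `≤ C_B·α` into a STRICT threshold (`PlaqSmall` is strict)
  obtain ⟨ε₁, hε₁⟩ : ∃ x : ℝ, x = Smax / (2 * (A₂ + 1)) := ⟨_, rfl⟩
  have hε₁0 : 0 < ε₁ := by rw [hε₁]; positivity
  -- the explicit guard: `1∕128 ≤ M(L)` for every `L ≥ 2`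
  have h128 : (1 : ℝ) / 128 ≤ M := by rw [hM, hC₂, hr₀, hNP]; exact one_div_128_le_ceiling L hL
  refine ⟨α₀, hα₀0, fun F θ hFL hθ0 J K hJK α hwin h24 hδ hαα Vd hVσ' U hUf hUg htop g w V hw hV hT1 hax hT5 => ?_⟩
  have hVσ : ∀ e, ‖logVec (su2Quat (Vd e))‖ ≤ M := fun e => (hVσ' e).trans h128
  have hPd : (F.P K).d = 3 := rfl
  have hPL : (F.P K).L = L := hFL
  have hm : K - J ≤ (F.P K).m + (F.P K).K := by show K - J ≤ F.m + K; omega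
  have hGF : (((5 * F.L : ℕ) : ℝ) ^ 2 / 4) = G := by rw [hG, hFL]
  -- thresholds on the gauged levels: the window inside, the (BKG) top value at the datum level
  obtain ⟨θg, hθg⟩ : ∃ f : ℕ → ℝ, f = fun t => if t < K - J then θ (K - t) else max (C_B * α) 0 + ε₁ := ⟨_, rfl⟩
  have hθg0 : ∀ t, 0 ≤ θg t := by
    intro t
    by_cases ht : t < K - J
    · rw [hθg]; simp only [ht, if_true]; exact hθ0 _
    · rw [hθg]; simp only [ht, if_false]; exact add_nonneg (le_max_right _ _) hε₁0.le
  have hθU : ∀ t, t ≤ K - J → PlaqSmall (θg t) (GaugeField.gaugeAct (g t) (Averaging.iter (fun k => blockAvg (P := F.P K) (j := k) ℰp) t U)) := by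
    intro t ht p
    rw [T4ReTrLipUnitary.plaqHol_gaugeAct, GaugeGroup.dist1_conj]
    rcases Nat.lt_or_ge t (K - J) with h | h
    · rw [hθg]; simp only [h, if_true]; exact hUg t (by omega) p
    · obtain rfl : t = K - J := le_antisymm ht h
      rw [hθg]; simp only [lt_irrefl, if_false]
      exact lt_of_le_of_lt ((htop p).trans (le_max_left _ _)) (lt_add_of_pos_right _ hε₁0)
  -- the window at an internal gauged level
  have hwinθ : ∀ t, t < K - J → G * θ (K - t) ≤ α := by
    intro t ht
    rw [← hGF]
    exact hwin (K - t) (by omega) (by omega)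
  have hg1 : ∀ t, t < K - J → (((((F.P K).d + 2) * (F.P K).L : ℕ) : ℝ) ^ 2 / 4) * θg t < ExpMeanLog.deltaSU (Fin 2) := by
    intro t ht; rw [hPd, hPL, ← hG, hθg]; simp only [ht, if_true]
    exact (hwinθ t ht).trans_lt hδ
  have hg2 : ∀ t, t < K - J → (((((F.P K).d + 2) * (F.P K).L : ℕ) : ℝ) ^ 2 / 4) * θg t ≤ 1 / 6 := by
    intro t ht; rw [hPd, hPL, ← hG, hθg]; simp only [ht, if_true]
    exact (hwinθ t ht).trans (h24.trans (by norm_num))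
  -- the general-top profile and its conditional quadratic step
  obtain ⟨s, hsm, hs0, hsb, hstep⟩ := exists_supProfile_relativeTower_start hm
    (fun t => GaugeField.gaugeAct (g t) (Averaging.iter (fun k => blockAvg (P := F.P K) (j := k) ℰp) t U)) w V hw hV hax hT5 θg hθg0 hθU hg1 hg2
  -- the START: the top of the tower is the datum (trivial top gauge), bond by bond
  have hstart : s (K - J) ≤ M := by
    refine hsm M fun b => ?_
    have hg0 : g (K - J) = fun _ => 1 := funext (hT1 (K - J) le_rfl)
    simp only [hg0, T4AxialGaugeFixing.gaugeAct_const_one]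
    exact norm_logVec_iter_le_of_mem_fibre F hJK hUf hVσ b
  -- the step in the bootstrap's currency
  obtain ⟨ρ, hρ⟩ : ∃ f : ℕ → ℝ, f = fun t => A₁ * θg t + A₂ * θg (t + 1) := ⟨_, rfl⟩
  have hstep' : ∀ t, t < K - J → s (t + 1) ≤ 1 / 4 → s t ≤ r₀ * s (t + 1) + ρ t + C₂ * s (t + 1) ^ 2 := by
    intro t ht h4
    have h := hstep t ht h4
    rw [hPd, hPL] at h
    refine h.trans (le_of_eq ?_)
    simp only [hρ, hA₁, hA₂, hC₂, hr₀, hNP, hG]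
    ring
  -- the POINTWISE source bound `ρ t ≤ α·Z ≤ Smax` (`t < K − J`)
  have hρS : ∀ t, t < K - J → ρ t ≤ Smax := by
    intro t ht
    have hα0 : 0 ≤ α := le_trans (mul_nonneg hG0.le (hθ0 (K - t))) (hwinθ t ht)
    have h1 : θg t ≤ α / G := by
      rw [hθg]; simp only [ht, if_true]
      rw [le_div_iff₀ hG0, mul_comm]; exact hwinθ t ht
    have h2 : θg (t + 1) ≤ α / G + C_B * α + ε₁ := by
      have hCα : 0 ≤ C_B * α := mul_nonneg hCB hα0
      by_cases h : t + 1 < K - J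
      · rw [hθg]; simp only [h, if_true]
        have h3 : θ (K - (t + 1)) ≤ α / G := by rw [le_div_iff₀ hG0, mul_comm]; exact hwinθ (t + 1) h
        linarith
      · rw [hθg]; simp only [h, if_false]
        rw [max_eq_left hCα]
        linarith [div_nonneg hα0 hG0.le]
    have h3 : ρ t ≤ α * Z + A₂ * ε₁ := by
      calc ρ t = A₁ * θg t + A₂ * θg (t + 1) := by rw [hρ]
        _ ≤ A₁ * (α / G) + A₂ * (α / G + C_B * α + ε₁) := add_le_add (mul_le_mul_of_nonneg_left h1 hA₁0) (mul_le_mul_of_nonneg_left h2 hA₂0)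
        _ = α * Z + A₂ * ε₁ := by rw [hZ]; ring
    have h4 : α * Z ≤ α₀ * Z := mul_le_mul_of_nonneg_right hαα hZ0
    have h5 : α₀ * Z ≤ Smax / 2 := by
      rw [hα₀]
      calc Smax / (2 * (Z + 1)) * Z ≤ Smax / (2 * (Z + 1)) * (Z + 1) := mul_le_mul_of_nonneg_left (by linarith) (by positivity)
        _ = Smax / 2 := by field_simp
    have h6 : A₂ * ε₁ ≤ Smax / 2 := by
      rw [hε₁]
      calc A₂ * (Smax / (2 * (A₂ + 1))) ≤ (A₂ + 1) * (Smax / (2 * (A₂ + 1))) := mul_le_mul_of_nonneg_right (by linarith) (by positivity)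
        _ = Smax / 2 := by field_simp
    linarith
  -- the bootstrap from the start, pointwise edition
  have hsmall₁ : Smax ≤ (1 - r₀) / 2 * M := by rw [hSmax]
  have hall := sup_bootstrap_start_pointwise s ρ (K - J) r₀ C₂ (1 / 4) M Smax hstart hs0 hρS hstep' hr00 hC₂0 hM4 hsmall₁ hMC
  intro t ht b
  exact (hsb t ht b).trans ((hall t ht).trans hM4)

/-! ## §2 The station letter: `hARC G` for every datum class `G` with the small-bond conjunct -/

/-- ★★★ **THE ARC LETTER OF THE SUPPLIER KNIT, FROM THE GUARD**: for every datum class `G` with the small-bond conjunct (`G F J V → arc(V e) ≤ 1∕128` at every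
bond), the `hARC G` hypothesis of LEAD's `supTowerLetter3_of_arc_discSplit` — VERBATIM its body: at the station prefix (sup window `((5L)²∕4)·θ i ≤ α` on
`J < i ≤ K`, `α ≤ 1∕24`, `α < δ_SU`, `157·α < L⁻²`, `α ≤ α₀`, `U₀ ∈ histGood θ`, `G F J (D_{J,K} U₀)`, (BKG), the partner `exp(ζ)·U₀ ∈ histGood θ` with (E4), the 17
`AxStage` clauses), every internal gauged level `1 ≤ i < K − J` of BOTH stage towers has arcs `≤ 1∕4`.  Proof: §1 on each tower; the partner is in the datum's
fibre by (E4) with `U₀`'s top field (✓`iter_eq_of_descendTo_eq`); `U₁` by the residual clauses (✓`residual_of_iter_eq`, ✓`gaugeAct_mem_fibre_iff_of_residual`,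
✓`gaugeAct_mem_histGood_iff`). [cite: Balaban1985RegularSpaces, Lemma 1 (1.24)-(1.26) p.79, (1.29) p.81; Balaban1985Averaging, Prop. 4 (128)-(135) pp.37-38] -/
theorem arcLetter_of_guard
    (G : (F : T3Family) → (J : ℕ) → GaugeField (F.P J) 0 (Matrix.specialUnitaryGroup (Fin 2) ℂ) → Prop)
    (hGs : ∀ (F : T3Family) (J : ℕ) (V : GaugeField (F.P J) 0 (Matrix.specialUnitaryGroup (Fin 2) ℂ)),
      G F J V → ∀ e, ‖logVec (su2Quat (V e))‖ ≤ 1 / 128) :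
      ∀ (L : ℕ), 1 < L → ∀ (C_B : ℝ), 0 ≤ C_B → ∃ α₀ : ℝ, 0 < α₀ ∧ ∀ (F : T3Family), F.L = L →
      ∀ (J K : ℕ) (hJK : J ≤ K) (θ : ℕ → ℝ), (∀ i, 0 ≤ θ i) → ∀ (α : ℝ), (∀ i, J < i → i ≤ K → (((5 * F.L : ℕ) : ℝ) ^ 2 / 4) * θ i ≤ α) →
        α ≤ 1 / 24 → α < deltaSU (Fin 2) → 157 * α < ((F.L : ℝ) ^ 2)⁻¹ → α ≤ α₀ →
        ∀ U₀ : GaugeField (F.P K) 0 (Matrix.specialUnitaryGroup (Fin 2) ℂ), U₀ ∈ histGood F ℰp θ K J →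
        G F J (descendTo F ℰp J K hJK U₀) →
        (∀ t, t ≤ K - J → ∀ p : Plaq (F.P K) t,
          dist1 (GaugeField.plaqHol (Averaging.iter (fun k => BlockAveraging.blockAvg (P := F.P K) (j := k) ℰp) t U₀) p) ≤
            C_B * α * (F.L : ℝ) ^ (2 * t) * ((F.L : ℝ)⁻¹) ^ (2 * (K - J))) →
        ∀ ζ : PBond (F.P K) 0 → EuclideanSpace ℝ (Fin 3), (∀ ℓ, ‖ζ ℓ‖ ≤ Real.pi) →
          (fun ℓ => expPoint (ζ ℓ) * U₀ ℓ : GaugeField (F.P K) 0 (Matrix.specialUnitaryGroup (Fin 2) ℂ)) ∈ histGood F ℰp θ K J →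
            descendTo F ℰp J K hJK (fun ℓ => expPoint (ζ ℓ) * U₀ ℓ : GaugeField (F.P K) 0 (Matrix.specialUnitaryGroup (Fin 2) ℂ)) = descendTo F ℰp J K hJK U₀ →
            ∀ (wt : (j : ℕ) → PBond (F.P K) j → PBond (F.P K) (j + 1) → ℝ)
            (lift : (j : ℕ) → GaugeField (F.P K) (j + 1) SU2 → GaugeField (F.P K) j SU2)
            (U₁ : GaugeField (F.P K) 0 SU2) (g g₀ : (j : ℕ) → Site (F.P K) j → SU2),
          (∀ j b e, wt j b e = if e.dir = b.dir ∧ (b.src b.dir - emb e.src b.dir).val < (F.P K).L then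
              ∏ ν ∈ Finset.univ.erase b.dir, max 0 (1 - ((rel (emb e.src) b.src ν).natAbs : ℝ) / (F.P K).L) else 0) →
          (∀ j X b, lift j X b = expPoint (∑ e, wt j b e • ((((F.P K).L : ℕ) : ℝ)⁻¹ • logVec (su2Quat (X e))))) →
          (∀ j, j < K - J → ∀ x, g j x =
            (axialT (lift j (GaugeField.gaugeAct (g (j + 1)) (Averaging.iter (fun k => blockAvg (P := F.P K) (j := k) ℰp) (j + 1) (fun ℓ => expPoint (ζ ℓ) * U₀ ℓ))))
                (emb (blockOf x)) x)⁻¹ *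
              g (j + 1) (blockOf x) * axialT (Averaging.iter (fun k => blockAvg (P := F.P K) (j := k) ℰp) j (fun ℓ => expPoint (ζ ℓ) * U₀ ℓ)) (emb (blockOf x)) x) →
          (∀ j, K - J ≤ j → ∀ y, g j y = 1) →
          (∀ j, j < K - J → ∀ y : Site (F.P K) (j + 1), g j (emb y) = g (j + 1) y) →
          (∀ X : GaugeField (F.P K) 0 SU2, ∀ j, j ≤ K - J →
            Averaging.iter (fun k => blockAvg (P := F.P K) (j := k) ℰp) j (GaugeField.gaugeAct (g 0) X) =
              GaugeField.gaugeAct (g j) (Averaging.iter (fun k => blockAvg (P := F.P K) (j := k) ℰp) j X)) →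
          (∀ j, j < K - J → ∀ x,
            axialT (GaugeField.gaugeAct (g j) (Averaging.iter (fun k => blockAvg (P := F.P K) (j := k) ℰp) j (fun ℓ => expPoint (ζ ℓ) * U₀ ℓ))) (emb (blockOf x)) x =
              axialT (lift j (GaugeField.gaugeAct (g (j + 1)) (Averaging.iter (fun k => blockAvg (P := F.P K) (j := k) ℰp) (j + 1) (fun ℓ => expPoint (ζ ℓ) * U₀ ℓ))))
                (emb (blockOf x)) x) →
          (∀ j, j < K - J →
            (blockAvg (P := F.P K) (j := j) ℰp).avg (GaugeField.gaugeAct (g j) (Averaging.iter (fun k => blockAvg (P := F.P K) (j := k) ℰp) j (fun ℓ => expPoint (ζ ℓ) * U₀ ℓ))) =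
              GaugeField.gaugeAct (g (j + 1)) (Averaging.iter (fun k => blockAvg (P := F.P K) (j := k) ℰp) (j + 1) (fun ℓ => expPoint (ζ ℓ) * U₀ ℓ))) →
          (∀ j, j < K - J → ∀ x, g₀ j x =
            (axialT (lift j (GaugeField.gaugeAct (g₀ (j + 1)) (Averaging.iter (fun k => blockAvg (P := F.P K) (j := k) ℰp) (j + 1) U₁)))
                (emb (blockOf x)) x)⁻¹ *
              g₀ (j + 1) (blockOf x) * axialT (Averaging.iter (fun k => blockAvg (P := F.P K) (j := k) ℰp) j U₁) (emb (blockOf x)) x) →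
          (∀ j, K - J ≤ j → ∀ y, g₀ j y = 1) →
          (∀ j, j < K - J → ∀ y : Site (F.P K) (j + 1), g₀ j (emb y) = g₀ (j + 1) y) →
          (∀ X : GaugeField (F.P K) 0 SU2, ∀ j, j ≤ K - J →
            Averaging.iter (fun k => blockAvg (P := F.P K) (j := k) ℰp) j (GaugeField.gaugeAct (g₀ 0) X) =
              GaugeField.gaugeAct (g₀ j) (Averaging.iter (fun k => blockAvg (P := F.P K) (j := k) ℰp) j X)) →
          (∀ j, j < K - J → ∀ x,
            axialT (GaugeField.gaugeAct (g₀ j) (Averaging.iter (fun k => blockAvg (P := F.P K) (j := k) ℰp) j U₁)) (emb (blockOf x)) x =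
              axialT (lift j (GaugeField.gaugeAct (g₀ (j + 1)) (Averaging.iter (fun k => blockAvg (P := F.P K) (j := k) ℰp) (j + 1) U₁)))
                (emb (blockOf x)) x) →
          (∀ j, j < K - J →
            (blockAvg (P := F.P K) (j := j) ℰp).avg (GaugeField.gaugeAct (g₀ j) (Averaging.iter (fun k => blockAvg (P := F.P K) (j := k) ℰp) j U₁)) =
              GaugeField.gaugeAct (g₀ (j + 1)) (Averaging.iter (fun k => blockAvg (P := F.P K) (j := k) ℰp) (j + 1) U₁)) →
          (∀ X : GaugeField (F.P K) 0 SU2, Averaging.iter (fun k => blockAvg (P := F.P K) (j := k) ℰp) (K - J) (GaugeField.gaugeAct (fun x => (g 0 x)⁻¹) X) = Averaging.iter (fun k => blockAvg (P := F.P K) (j := k) ℰp) (K - J) X) →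
          (∀ X : GaugeField (F.P K) 0 SU2, Averaging.iter (fun k => blockAvg (P := F.P K) (j := k) ℰp) (K - J) (GaugeField.gaugeAct (g₀ 0) X) = Averaging.iter (fun k => blockAvg (P := F.P K) (j := k) ℰp) (K - J) X) →
          U₀ = GaugeField.gaugeAct (fun x => (g 0 x)⁻¹ * g₀ 0 x) U₁ →

                      ∀ i, 1 ≤ i → i < K - J → ∀ e : PBond (F.P K) i,
            ‖logVec (su2Quat (GaugeField.gaugeAct (g i) (Averaging.iter (fun k => blockAvg (P := F.P K) (j := k) ℰp) i (fun ℓ => expPoint (ζ ℓ) * U₀ ℓ)) e))‖ ≤ 1 / 4 ∧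
            ‖logVec (su2Quat (GaugeField.gaugeAct (g₀ i) (Averaging.iter (fun k => blockAvg (P := F.P K) (j := k) ℰp) i U₁) e))‖ ≤ 1 / 4 := by
  intro L hL C_B hCB
  obtain ⟨α₀, hα₀, H⟩ := exists_alpha_supBound_window L hL C_B hCB
  refine ⟨α₀, hα₀, ?_⟩
  intro F hFL J K hJK θ hθ0 α hwin h24 hδ _h157 hαα U₀ hU₀g hG hBKG ζ _hζ hWg hfib wt lift U₁ g g₀ hwt hlift _hg hgtop _hgemb _hT3 hT4 havg
    _hg₀ hg₀top _hg₀emb _hT3' hT4' havg₀ hres hres₀ hU₀ i _hi1 hiK e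
  -- the datum `D_{J,K} U₀` and its guard
  have hV : ∀ e', ‖logVec (su2Quat (descendTo F ℰp J K hJK U₀ e'))‖ ≤ 1 / 128 := hGs F J _ hG
  have hFL0 : (0 : ℝ) < (F.L : ℝ) := by rw [hFL]; exact_mod_cast (lt_trans Nat.zero_lt_one hL)
  have hLL : (F.L : ℝ) ^ (2 * (K - J)) * ((F.L : ℝ)⁻¹) ^ (2 * (K - J)) = 1 := by
    rw [← mul_pow, mul_inv_cancel₀ hFL0.ne', one_pow]
  -- the top (datum-level) plaquettes of `U₀`: the (BKG) clause at `t = K − J`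
  have htop₀ : ∀ p : Plaq (F.P K) (K - J),
      dist1 (GaugeField.plaqHol (Averaging.iter (fun k => blockAvg (P := F.P K) (j := k) ℰp) (K - J) U₀) p) ≤ C_B * α := by
    intro p
    have h := hBKG (K - J) le_rfl p
    rw [mul_assoc (C_B * α), hLL, mul_one] at h
    exact h
  -- the partner `W := exp(ζ)·U₀`: in the datum's fibre by (E4), same top field
  have hWf : (fun ℓ => expPoint (ζ ℓ) * U₀ ℓ : GaugeField (F.P K) 0 (Matrix.specialUnitaryGroup (Fin 2) ℂ)) ∈
      fibre F ℰp J K hJK (descendTo F ℰp J K hJK U₀) := hfib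
  have hWtop : ∀ p : Plaq (F.P K) (K - J),
      dist1 (GaugeField.plaqHol (Averaging.iter (fun k => blockAvg (P := F.P K) (j := k) ℰp) (K - J)
        (fun ℓ => expPoint (ζ ℓ) * U₀ ℓ : GaugeField (F.P K) 0 (Matrix.specialUnitaryGroup (Fin 2) ℂ))) p) ≤ C_B * α := by
    intro p
    rw [iter_eq_of_descendTo_eq F hJK hfib]
    exact htop₀ p
  -- the comparison history `U₁`: `U₀ = (g_0⁻¹·g₀_0) • U₁`, residual ⟹ same fibre, same `histGood`, same top field
  have hwres : ∀ X : GaugeField (F.P K) 0 SU2,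
      descendTo F ℰp J K hJK (GaugeField.gaugeAct (fun x => (g 0 x)⁻¹ * g₀ 0 x) X) = descendTo F ℰp J K hJK X := by
    refine residual_of_iter_eq F hJK _ fun X => ?_
    have e1 : GaugeField.gaugeAct (fun x => (g 0 x)⁻¹ * g₀ 0 x) X =
        GaugeField.gaugeAct (fun x => (g 0 x)⁻¹) (GaugeField.gaugeAct (g₀ 0) X) := gaugeAct_mul_eq (fun x => (g 0 x)⁻¹) (g₀ 0) X
    rw [e1, hres, hres₀]
  have hU₀f : U₀ ∈ fibre F ℰp J K hJK (descendTo F ℰp J K hJK U₀) := rfl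
  have hU₁f : U₁ ∈ fibre F ℰp J K hJK (descendTo F ℰp J K hJK U₀) := by
    rw [← gaugeAct_mem_fibre_iff_of_residual F hJK hwres U₁, ← hU₀]; exact hU₀f
  have hU₁g : U₁ ∈ histGood F ℰp θ K J := by
    rw [← gaugeAct_mem_histGood_iff F (fun x => (g 0 x)⁻¹ * g₀ 0 x) θ J U₁, ← hU₀]; exact hU₀g
  have hU₁top : ∀ p : Plaq (F.P K) (K - J),
      dist1 (GaugeField.plaqHol (Averaging.iter (fun k => blockAvg (P := F.P K) (j := k) ℰp) (K - J) U₁) p) ≤ C_B * α := by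
    intro p
    have e1 : Averaging.iter (fun k => blockAvg (P := F.P K) (j := k) ℰp) (K - J) U₁ =
        Averaging.iter (fun k => blockAvg (P := F.P K) (j := k) ℰp) (K - J) U₀ := by
      have e2 : GaugeField.gaugeAct (fun x => (g 0 x)⁻¹ * g₀ 0 x) U₁ =
          GaugeField.gaugeAct (fun x => (g 0 x)⁻¹) (GaugeField.gaugeAct (g₀ 0) U₁) := gaugeAct_mul_eq (fun x => (g 0 x)⁻¹) (g₀ 0) U₁
      rw [hU₀, e2, hres, hres₀]
    rw [e1]
    exact htop₀ p
  -- §1 on each tower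
  constructor
  · exact H F θ hFL hθ0 J K hJK α hwin h24 hδ hαα (descendTo F ℰp J K hJK U₀) hV _ hWf hWg hWtop g wt
      (fun t => lift t (GaugeField.gaugeAct (g (t + 1)) (Averaging.iter (fun k => blockAvg (P := F.P K) (j := k) ℰp) (t + 1)
        (fun ℓ => expPoint (ζ ℓ) * U₀ ℓ : GaugeField (F.P K) 0 (Matrix.specialUnitaryGroup (Fin 2) ℂ)))))
      (fun t _ b e' => hwt t b e') (fun t _ b => hlift t _ b) hgtop (fun t ht z => hT4 t ht z) (fun t ht => havg t ht) i hiK.le e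
  · exact H F θ hFL hθ0 J K hJK α hwin h24 hδ hαα (descendTo F ℰp J K hJK U₀) hV U₁ hU₁f hU₁g hU₁top g₀ wt
      (fun t => lift t (GaugeField.gaugeAct (g₀ (t + 1)) (Averaging.iter (fun k => blockAvg (P := F.P K) (j := k) ℰp) (t + 1) U₁)))
      (fun t _ b e' => hwt t b e') (fun t _ b => hlift t _ b) hg₀top (fun t ht z => hT4' t ht z) (fun t ht => havg₀ t ht) i hiK.le e

end Summit.QuantumFields.YangMills.Theorems.FluctuationComparisonRegPrIntLS2BetaArcLetterOfGuard

end
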